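import Literature.Analysis.FluidPDE.ElgindiEllipticVeryWeak
import Literature.Analysis.FluidPDE.ElgindiPolarEnergyWeighted
import HarnessLib

/-!
# Radially weighted energy bounds for the weak solution of Elgindi's polar elliptic problem
([Elgindi2021] §7.1 Proposition 7.1 and §7.3 Proposition 7.7 Step 1: the weight `w = (1+R)²/R²`)

Topic `Literature/Analysis/FluidPDE`. Support file (definitions with bodies and proved theorems, no
named facts) on the proof path of the named fact
`Literature.Analysis.FluidPDE.Elgindi.ElgindiGhoulMasmoudi2021_stabilityCore`
(`ElgindiStabilityDecomposition.lean`). T. M. Elgindi, Ann. of Math. 194 (2021) =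
arXiv:1904.04795, §7.1 Proposition 7.1 (the `𝓗⁰`-estimate with the radial weight
`w(R) = (1+R)²/R²`, §1.7.2) and §7.3 proof of Proposition 7.7, Step 1 (pp. 20–21: the weighted
energy identity, the tree's `integral_strip_ellipticOp_mul_self_weight`).

The Lax–Milgram solution `U` of `ElgindiEllipticWeakExistence.lean` lives in the unweighted energy
space. Here we prove that it carries the radially weighted energy
`∫∫ w(R)²·(U₀² + U₁² + U₂² + U₃²) ≤ C∫∫ w²F²` (`weightedEnergy_le`), `w = (1+R)²/R²`, WITHOUT a second
Lax–Milgram construction: for the regularised weights `W_ε = (1+R)⁴/(R²+ε)²` (smooth and bounded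
for `ε > 0`, increasing to `w²` as `ε ↓ 0`) the multiplier `T_ε : Jχ ↦ J(W_εχ)` is a bounded
operator of `E⁴` preserving the energy space, the quadratic identity `B(U, T_εU) = Q_ε(U)` (the
weighted energy identity on graphs) extends to the energy space by continuity, `Q_ε` is coercive
for the `W_ε`-weighted norms uniformly in `ε` (`0 < α ≤ 1/4`; weighted Poincaré `12‖Ψ‖² ≤ ‖∂_θΨ‖²`
slice by slice), and testing the weak equation with `T_εU` gives bounds uniform in `ε`; monotone
convergence concludes.
-/

noncomputable section

open MeasureTheory Set Real Filter Function
open _root_.Topology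
open scoped ENNReal InnerProductSpace

namespace Literature.Analysis.FluidPDE

namespace Elgindi

/-! ### Multiplication operators on `L²(strip)` -/

/-- Multiplication by a measurable function bounded on the strip preserves `L²(strip)`. [folklore] -/
theorem memLp_mul_of_bound {b : ℝ × ℝ → ℝ} (hb : Measurable b) {C : ℝ} (hC : ∀ p ∈ strip, |b p| ≤ C) (f : L2Strip) :
    MemLp (fun p => b p * (f : ℝ × ℝ → ℝ) p) 2 stripMeasure := by
  refine MemLp.of_le_mul (Lp.memLp f) (hb.aestronglyMeasurable.mul (Lp.memLp f).1) (c := C) ?_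
  have h : ∀ᵐ p ∂(volume.restrict strip), ‖b p * (f : ℝ × ℝ → ℝ) p‖ ≤ C * ‖(f : ℝ × ℝ → ℝ) p‖ :=
    (ae_restrict_iff' measurableSet_strip).2 (ae_of_all _ fun p hp => by
      rw [Real.norm_eq_abs, Real.norm_eq_abs, abs_mul]
      exact mul_le_mul_of_nonneg_right (hC p hp) (abs_nonneg _))
  exact h

/-- **The multiplication operator** `f ↦ b·f` on `L²(strip)` for `b` measurable and bounded on the
strip. [folklore] -/
def mulL2 {b : ℝ × ℝ → ℝ} (hb : Measurable b) {C : ℝ} (hC : ∀ p ∈ strip, |b p| ≤ C) : L2Strip →L[ℝ] L2Strip :=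
  LinearMap.mkContinuous
    { toFun := fun f => (memLp_mul_of_bound hb hC f).toLp _
      map_add' := fun f g => by
        refine (MemLp.toLp_eq_toLp_iff _ _).2 ?_ |>.trans (MemLp.toLp_add _ _)
        filter_upwards [Lp.coeFn_add f g] with p hp
        simp only [hp, Pi.add_apply]; ring
      map_smul' := fun c f => by
        refine (MemLp.toLp_eq_toLp_iff _ _).2 ?_ |>.trans (MemLp.toLp_const_smul _ _)
        filter_upwards [Lp.coeFn_smul c f] with p hp
        simp only [hp, Pi.smul_apply, smul_eq_mul, RingHom.id_apply]; ring }
    |C| fun f => by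
      simp only [LinearMap.coe_mk, AddHom.coe_mk, Lp.norm_toLp]
      have h := eLpNorm_le_mul_eLpNorm_of_ae_le_mul (p := 2) (μ := stripMeasure) (f := fun p => b p * (f : ℝ × ℝ → ℝ) p)
        (g := (f : ℝ × ℝ → ℝ)) (c := |C|) ?_
      · have hf : eLpNorm (f : ℝ × ℝ → ℝ) 2 stripMeasure ≠ ⊤ := (Lp.memLp f).eLpNorm_ne_top
        calc (eLpNorm (fun p => b p * (f : ℝ × ℝ → ℝ) p) 2 stripMeasure).toReal
            ≤ (ENNReal.ofReal |C| * eLpNorm (f : ℝ × ℝ → ℝ) 2 stripMeasure).toReal :=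
              ENNReal.toReal_mono (ENNReal.mul_ne_top ENNReal.ofReal_ne_top hf) h
          _ = |C| * ‖f‖ := by rw [ENNReal.toReal_mul, ENNReal.toReal_ofReal (abs_nonneg C), Lp.norm_def]
      · have h' : ∀ᵐ p ∂(volume.restrict strip), ‖b p * (f : ℝ × ℝ → ℝ) p‖ ≤ |C| * ‖(f : ℝ × ℝ → ℝ) p‖ :=
          (ae_restrict_iff' measurableSet_strip).2 (ae_of_all _ fun p hp => by
            rw [Real.norm_eq_abs, Real.norm_eq_abs, abs_mul]
            exact mul_le_mul_of_nonneg_right ((hC p hp).trans (le_abs_self C)) (abs_nonneg _))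
        exact h'

/-- The a.e. representative of `b·f`. [folklore] -/
theorem mulL2_ae_eq {b : ℝ × ℝ → ℝ} (hb : Measurable b) {C : ℝ} (hC : ∀ p ∈ strip, |b p| ≤ C) (f : L2Strip) :
    (mulL2 hb hC f : ℝ × ℝ → ℝ) =ᵐ[volume.restrict strip] fun p => b p * (f : ℝ × ℝ → ℝ) p :=
  (memLp_mul_of_bound hb hC f).coeFn_toLp

/-- `b·(toL2 g) = toL2 (b·g)` for square-integrable `g`. [folklore] -/
theorem mulL2_toL2 {b : ℝ × ℝ → ℝ} (hb : Measurable b) {C : ℝ} (hC : ∀ p ∈ strip, |b p| ≤ C) {g : ℝ × ℝ → ℝ}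
    (hg : MemLp g 2 stripMeasure) (hbg : MemLp (fun p => b p * g p) 2 stripMeasure) :
    mulL2 hb hC (toL2 g) = toL2 fun p => b p * g p := by
  apply Lp.ext
  have h1 := mulL2_ae_eq hb hC (toL2 g)
  have h2 := toL2_ae_eq' hg
  have h3 := toL2_ae_eq' hbg
  refine h1.trans ?_ |>.trans h3.symm
  filter_upwards [h2] with p hp
  rw [hp]

/-- The pairing `⟨b·u, v⟩ = ∫∫ b u v`. [folklore] -/
theorem inner_mulL2 {b : ℝ × ℝ → ℝ} (hb : Measurable b) {C : ℝ} (hC : ∀ p ∈ strip, |b p| ≤ C) (u v : L2Strip) :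
    ⟪mulL2 hb hC u, v⟫_ℝ = ∫ p in strip, b p * (u : ℝ × ℝ → ℝ) p * (v : ℝ × ℝ → ℝ) p := by
  rw [inner_L2Strip]
  refine integral_congr_ae ?_
  filter_upwards [mulL2_ae_eq hb hC u] with p hp
  rw [hp]

/-- Monotonicity of the quadratic pairing in the multiplier: `b₁ ≤ b₂` on the strip gives
`⟨b₁u, u⟩ ≤ ⟨b₂u, u⟩`. [folklore] -/
theorem inner_mulL2_mono {b₁ b₂ : ℝ × ℝ → ℝ} (hb₁ : Measurable b₁) (hb₂ : Measurable b₂) {C₁ C₂ : ℝ}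
    (hC₁ : ∀ p ∈ strip, |b₁ p| ≤ C₁) (hC₂ : ∀ p ∈ strip, |b₂ p| ≤ C₂) (hle : ∀ p ∈ strip, b₁ p ≤ b₂ p) (u : L2Strip) :
    ⟪mulL2 hb₁ hC₁ u, u⟫_ℝ ≤ ⟪mulL2 hb₂ hC₂ u, u⟫_ℝ := by
  rw [inner_mulL2, inner_mulL2]
  have i : ∀ {b : ℝ × ℝ → ℝ} (hb : Measurable b) {C : ℝ} (hC : ∀ p ∈ strip, |b p| ≤ C),
      IntegrableOn (fun p => b p * (u : ℝ × ℝ → ℝ) p * (u : ℝ × ℝ → ℝ) p) strip := fun {b} hb {C} hC => by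
    have h := L2.integrable_inner (𝕜 := ℝ) (mulL2 hb hC u) u
    have h' : IntegrableOn (fun p => (mulL2 hb hC u : ℝ × ℝ → ℝ) p * (u : ℝ × ℝ → ℝ) p) strip := by
      refine (integrable_congr ?_).1 h
      exact ae_of_all _ fun p => by simp only [RCLike.inner_apply, conj_trivial]; ring
    refine h'.congr_fun_ae ?_
    filter_upwards [mulL2_ae_eq hb hC u] with p hp
    rw [hp]
  refine setIntegral_mono_on (i hb₁ hC₁) (i hb₂ hC₂) measurableSet_strip fun p hp => ?_
  have := hle p hp
  nlinarith [mul_self_nonneg ((u : ℝ × ℝ → ℝ) p)]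

/-! ### The regularised weights `W_ε = (1+R)⁴/(R²+ε)²` -/

/-- The regularised weight `W_ε(R) = (1+R)⁴/(R²+ε)²`. [cite: Elgindi2021, §1.7.2 (p. 7 of arXiv:1904.04795): w = (1+R)²/R²] -/
def approxWeight (ε R : ℝ) : ℝ := (1 + R) ^ 4 / (R ^ 2 + ε) ^ 2

/-- Unfolding. [folklore] -/
theorem approxWeight_apply (ε R : ℝ) : approxWeight ε R = (1 + R) ^ 4 / (R ^ 2 + ε) ^ 2 := rfl

/-- `W_ε` is smooth on `ℝ` for `ε > 0`. [folklore] -/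
theorem contDiff_approxWeight {ε : ℝ} (hε : 0 < ε) {n : WithTop ℕ∞} : ContDiff ℝ n (approxWeight ε) := by
  unfold approxWeight
  refine ContDiff.div (by fun_prop) (by fun_prop) fun R => ?_
  positivity

/-- `W_ε > 0` on `R > 0`… indeed on `R > −1`; we use `R ≥ 0`. [folklore] -/
theorem approxWeight_pos {ε : ℝ} (hε : 0 < ε) {R : ℝ} (hR : 0 ≤ R) : 0 < approxWeight ε R := by
  unfold approxWeight; positivity

/-- `W_ε ≤ 16/ε² + 16` on `R ≥ 0`. [folklore] -/
theorem approxWeight_le {ε : ℝ} (hε : 0 < ε) {R : ℝ} (hR : 0 ≤ R) : approxWeight ε R ≤ 16 / ε ^ 2 + 16 := by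
  unfold approxWeight
  rcases le_or_gt R 1 with h | h
  · have h1 : (1 + R) ^ 4 ≤ 16 := by nlinarith [pow_le_pow_left₀ (by linarith : (0:ℝ) ≤ 1 + R) (by linarith : 1 + R ≤ 2) 4]
    have h2 : ε ^ 2 ≤ (R ^ 2 + ε) ^ 2 := pow_le_pow_left₀ hε.le (by nlinarith) 2
    calc (1 + R) ^ 4 / (R ^ 2 + ε) ^ 2 ≤ 16 / ε ^ 2 := by
          rw [div_le_div_iff₀ (by positivity) (by positivity)]; nlinarith [pow_pos hε 2]
      _ ≤ 16 / ε ^ 2 + 16 := by linarith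
  · have h3 : (1 + R) ^ 4 ≤ 16 * (R ^ 2 + ε) ^ 2 := by
      have : (1 + R) ^ 2 ≤ 4 * (R ^ 2 + ε) := by nlinarith
      nlinarith [pow_le_pow_left₀ (by positivity : (0:ℝ) ≤ (1 + R) ^ 2) this 2]
    calc (1 + R) ^ 4 / (R ^ 2 + ε) ^ 2 ≤ 16 := by rw [div_le_iff₀ (by positivity)]; linarith
      _ ≤ 16 / ε ^ 2 + 16 := by have : 0 ≤ 16 / ε ^ 2 := by positivity
                                linarith

/-- `W_ε ≤ w² = (1+R)⁴/R⁴` on `R > 0`. [folklore] -/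
theorem approxWeight_le_radialWeight_sq {ε : ℝ} (hε : 0 < ε) {R : ℝ} (hR : 0 < R) : approxWeight ε R ≤ radialWeight R ^ 2 := by
  have e : radialWeight R ^ 2 = (1 + R) ^ 4 / (R ^ 2) ^ 2 := by
    unfold radialWeight; rw [div_pow, ← pow_mul]
  rw [e, approxWeight_apply]
  have hb : (0:ℝ) < (R ^ 2) ^ 2 := by positivity
  have hc : (R ^ 2) ^ 2 ≤ (R ^ 2 + ε) ^ 2 := pow_le_pow_left₀ (sq_nonneg R) (by linarith) 2
  exact div_le_div_of_nonneg_left (by positivity) hb hc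

/-- `W_ε` increases as `ε` decreases. [folklore] -/
theorem approxWeight_mono {ε ε' : ℝ} (hε : 0 < ε) (h : ε ≤ ε') (R : ℝ) : approxWeight ε' R ≤ approxWeight ε R := by
  rw [approxWeight_apply, approxWeight_apply]
  have hb : (0:ℝ) < (R ^ 2 + ε) ^ 2 := by positivity
  have hc : (R ^ 2 + ε) ^ 2 ≤ (R ^ 2 + ε') ^ 2 := pow_le_pow_left₀ (by positivity) (by linarith) 2
  exact div_le_div_of_nonneg_left (by positivity) hb hc

/-- `W_ε → w²` as `ε ↓ 0`, on `R > 0`. [folklore] -/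
theorem tendsto_approxWeight {R : ℝ} (hR : 0 < R) : Tendsto (fun ε => approxWeight ε R) (𝓝[>] 0) (𝓝 (radialWeight R ^ 2)) := by
  have e : radialWeight R ^ 2 = (1 + R) ^ 4 / (R ^ 2 + 0) ^ 2 := by
    unfold radialWeight; rw [add_zero, div_pow, ← pow_mul, ← pow_mul]
  rw [e]
  unfold approxWeight
  refine Tendsto.mono_left ?_ nhdsWithin_le_nhds
  refine Tendsto.div tendsto_const_nhds ((tendsto_const_nhds.add tendsto_id).pow 2) ?_
  positivity

/-- The logarithmic derivative `R·W_ε′ = W_ε·(4R/(1+R) − 4R²/(R²+ε))`. [folklore] -/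
theorem hasDerivAt_approxWeight {ε : ℝ} (hε : 0 < ε) {R : ℝ} (hR : 0 ≤ R) :
    HasDerivAt (approxWeight ε) (approxWeight ε R * (4 / (1 + R) - 4 * R / (R ^ 2 + ε))) R := by
  unfold approxWeight
  have h1 : HasDerivAt (fun R : ℝ => (1 + R) ^ 4) (4 * (1 + R) ^ 3) R := by
    have h := ((hasDerivAt_id R).const_add 1).pow 4
    have h' : HasDerivAt (fun R : ℝ => (1 + R) ^ 4) (((4:ℕ):ℝ) * (1 + R) ^ (4 - 1) * 1) R := h
    refine h'.congr_deriv ?_; norm_num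
  have h2 : HasDerivAt (fun R : ℝ => (R ^ 2 + ε) ^ 2) (2 * (R ^ 2 + ε) * (2 * R)) R := by
    have hp : HasDerivAt (fun R : ℝ => R ^ 2 + ε) (2 * R) R := by
      have := (hasDerivAt_pow 2 R).add_const ε
      have h' : HasDerivAt (fun R : ℝ => R ^ 2 + ε) (((2:ℕ):ℝ) * R ^ (2 - 1)) R := this
      refine h'.congr_deriv ?_; norm_num
    have h := hp.pow 2
    have h' : HasDerivAt (fun R : ℝ => (R ^ 2 + ε) ^ 2) (((2:ℕ):ℝ) * (R ^ 2 + ε) ^ (2 - 1) * (2 * R)) R := h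
    refine h'.congr_deriv ?_; norm_num
  have hne : (R ^ 2 + ε) ^ 2 ≠ 0 := by positivity
  have := h1.div h2 hne
  refine this.congr_deriv ?_
  have h1R : (1 + R) ≠ 0 := by linarith
  have h2R : R ^ 2 + ε ≠ 0 := by positivity
  field_simp
  ring

/-! ### The multipliers on the strip and the operator `T_ε : Jχ ↦ J(W_εχ)` -/

section operator

variable (α : ℝ) {ε : ℝ} (hε : 0 < ε)

/-- The weight as a function on the plane. [folklore] -/
def bW (ε : ℝ) (p : ℝ × ℝ) : ℝ := approxWeight ε p.1

/-- The radial-derivative multiplier `α R W_ε′(R)`. [folklore] -/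
def bD (α ε : ℝ) (p : ℝ × ℝ) : ℝ := α * p.1 * deriv (approxWeight ε) p.1

include hε

/-- `bW` is measurable. [folklore] -/
theorem measurable_bW : Measurable (bW ε) := ((contDiff_approxWeight hε (n := 0)).continuous.measurable).comp measurable_fst

/-- `bW` is bounded on the strip. [folklore] -/
theorem bW_bound : ∀ p ∈ strip, |bW ε p| ≤ 16 / ε ^ 2 + 16 := fun p hp => by
  unfold bW
  rw [abs_of_pos (approxWeight_pos hε hp.1.le)]
  exact approxWeight_le hε hp.1.le

/-- The derivative of `W_ε` as a function. [folklore] -/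
theorem deriv_approxWeight {R : ℝ} (hR : 0 ≤ R) : deriv (approxWeight ε) R = approxWeight ε R * (4 / (1 + R) - 4 * R / (R ^ 2 + ε)) :=
  (hasDerivAt_approxWeight hε hR).deriv

/-- `bD` is measurable. [folklore] -/
theorem measurable_bD : Measurable (bD α ε) := by
  unfold bD
  have hc : Continuous (deriv (approxWeight ε)) := (contDiff_approxWeight hε (n := 1)).continuous_deriv le_rfl
  exact ((measurable_const.mul measurable_fst).mul (hc.measurable.comp measurable_fst))

/-- `bD` is bounded on the strip: `|α R W_ε′| ≤ 8|α|(16/ε² + 16)`. [folklore] -/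
theorem bD_bound : ∀ p ∈ strip, |bD α ε p| ≤ 8 * |α| * (16 / ε ^ 2 + 16) := fun p hp => by
  unfold bD
  have hR : 0 < p.1 := hp.1
  rw [deriv_approxWeight hε hR.le]
  have hW := approxWeight_pos hε hR.le
  have hWle := approxWeight_le hε hR.le
  -- `|R (4/(1+R) − 4R/(R²+ε))| ≤ 8`
  have h1 : |p.1 * (4 / (1 + p.1) - 4 * p.1 / (p.1 ^ 2 + ε))| ≤ 8 := by
    have a1 : 0 ≤ p.1 * (4 / (1 + p.1)) := by positivity
    have a2 : p.1 * (4 / (1 + p.1)) ≤ 4 := by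
      rw [mul_div_assoc', div_le_iff₀ (by linarith)]; linarith
    have a3 : 0 ≤ p.1 * (4 * p.1 / (p.1 ^ 2 + ε)) := by positivity
    have a4 : p.1 * (4 * p.1 / (p.1 ^ 2 + ε)) ≤ 4 := by
      rw [mul_div_assoc', div_le_iff₀ (by positivity)]; nlinarith
    rw [mul_sub, abs_le]; constructor <;> linarith
  calc |α * p.1 * (approxWeight ε p.1 * (4 / (1 + p.1) - 4 * p.1 / (p.1 ^ 2 + ε)))|
      = |α| * approxWeight ε p.1 * |p.1 * (4 / (1 + p.1) - 4 * p.1 / (p.1 ^ 2 + ε))| := by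
        rw [show α * p.1 * (approxWeight ε p.1 * (4 / (1 + p.1) - 4 * p.1 / (p.1 ^ 2 + ε))) =
          α * approxWeight ε p.1 * (p.1 * (4 / (1 + p.1) - 4 * p.1 / (p.1 ^ 2 + ε))) by ring, abs_mul, abs_mul, abs_of_pos hW]
    _ ≤ |α| * (16 / ε ^ 2 + 16) * 8 := by gcongr
    _ = 8 * |α| * (16 / ε ^ 2 + 16) := by ring

/-- Multiplication by `W_ε` on `L²(strip)`. [folklore] -/
def mulW : L2Strip →L[ℝ] L2Strip := mulL2 (measurable_bW hε) (bW_bound hε)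

/-- Multiplication by `α R W_ε′` on `L²(strip)`. [folklore] -/
def mulD : L2Strip →L[ℝ] L2Strip := mulL2 (measurable_bD α hε) (bD_bound α hε)

/-- The components of `T_ε U = (W U₀, W U₁ + D U₀, W U₂, W U₃)`. [folklore] -/
def weightOpFun (U : E4) : Fin 4 → L2Strip
  | 0 => mulW hε (U 0)
  | 1 => mulW hε (U 1) + mulD α hε (U 0)
  | 2 => mulW hε (U 2)
  | 3 => mulW hε (U 3)

/-- `T_ε` as a linear map. [folklore] -/
def weightOpLin : E4 →ₗ[ℝ] E4 where
  toFun U := WithLp.toLp 2 (weightOpFun α hε U)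
  map_add' U V := by
    ext k : 1
    fin_cases k <;> (simp [weightOpFun]; try abel)
  map_smul' c U := by
    ext k : 1
    fin_cases k <;> simp [weightOpFun, smul_add]

/-- A crude operator bound for `T_ε`. [folklore] -/
theorem norm_weightOpLin_le (U : E4) : ‖weightOpLin α hε U‖ ≤ 2 * (‖mulW hε‖ + ‖mulD α hε‖) * ‖U‖ := by
  set M := ‖mulW hε‖ + ‖mulD α hε‖ with hM
  have hM0 : 0 ≤ M := by positivity
  have hcomp : ∀ k : Fin 4, ‖weightOpLin α hε U k‖ ≤ M * ‖U‖ := by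
    intro k
    have hk : ∀ j : Fin 4, ‖U j‖ ≤ ‖U‖ := fun j => PiLp.norm_apply_le U j
    have b1 : ∀ j : Fin 4, ‖mulW hε (U j)‖ ≤ ‖mulW hε‖ * ‖U‖ := fun j =>
      ((mulW hε).le_opNorm _).trans (mul_le_mul_of_nonneg_left (hk j) (norm_nonneg _))
    have b2 : ‖mulD α hε (U 0)‖ ≤ ‖mulD α hε‖ * ‖U‖ :=
      ((mulD α hε).le_opNorm _).trans (mul_le_mul_of_nonneg_left (hk 0) (norm_nonneg _))
    have hD0 : 0 ≤ ‖mulD α hε‖ * ‖U‖ := by positivity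
    have hW0 : 0 ≤ ‖mulW hε‖ * ‖U‖ := by positivity
    fin_cases k
    · show ‖mulW hε (U 0)‖ ≤ M * ‖U‖; rw [hM]; nlinarith [b1 0]
    · show ‖mulW hε (U 1) + mulD α hε (U 0)‖ ≤ M * ‖U‖
      rw [hM]; exact (norm_add_le _ _).trans (by nlinarith [b1 1, b2])
    · show ‖mulW hε (U 2)‖ ≤ M * ‖U‖; rw [hM]; nlinarith [b1 2]
    · show ‖mulW hε (U 3)‖ ≤ M * ‖U‖; rw [hM]; nlinarith [b1 3]
  have hsq : ‖weightOpLin α hε U‖ ^ 2 ≤ (2 * M * ‖U‖) ^ 2 := by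
    rw [PiLp.norm_sq_eq_of_L2, Fin.sum_univ_four]
    have h0 := hcomp 0; have h1 := hcomp 1; have h2 := hcomp 2; have h3 := hcomp 3
    have hMU : 0 ≤ M * ‖U‖ := by positivity
    nlinarith [pow_le_pow_left₀ (norm_nonneg _) h0 2, pow_le_pow_left₀ (norm_nonneg _) h1 2,
      pow_le_pow_left₀ (norm_nonneg _) h2 2, pow_le_pow_left₀ (norm_nonneg _) h3 2]
  have h2M : 0 ≤ 2 * M * ‖U‖ := by positivity
  have := le_of_sq_le_sq hsq h2M
  simpa [mul_assoc] using this

/-- **The multiplier operator** `T_ε : E⁴ →L E⁴`, `U ↦ (W_εU₀, W_εU₁ + αRW_ε′U₀, W_εU₂, W_εU₃)` —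
on graphs, `T_ε(Jχ) = J(W_εχ)`. [folklore] -/
def weightOp : E4 →L[ℝ] E4 := (weightOpLin α hε).mkContinuous (2 * (‖mulW hε‖ + ‖mulD α hε‖)) (norm_weightOpLin_le α hε)

/-- Components of `T_ε U`. [folklore] -/
theorem weightOp_apply_zero (U : E4) : weightOp α hε U 0 = mulW hε (U 0) := rfl
/-- Components of `T_ε U`. [folklore] -/
theorem weightOp_apply_one (U : E4) : weightOp α hε U 1 = mulW hε (U 1) + mulD α hε (U 0) := rfl
/-- Components of `T_ε U`. [folklore] -/
theorem weightOp_apply_two (U : E4) : weightOp α hε U 2 = mulW hε (U 2) := rfl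
/-- Components of `T_ε U`. [folklore] -/
theorem weightOp_apply_three (U : E4) : weightOp α hε U 3 = mulW hε (U 3) := rfl

end operator

/-! ### `T_ε` on graphs and on the energy space -/

/-- The weighted profile `W_ε·χ`. [folklore] -/
def wProfile (ε : ℝ) (χ : ℝ → ℝ → ℝ) : ℝ → ℝ → ℝ := fun R θ => approxWeight ε R * χ R θ

/-- `K`-moments commute with radial multipliers. [folklore] -/
theorem kMoment_radial_mul (c : ℝ → ℝ) (f : ℝ → ℝ → ℝ) (z : ℝ) : kMoment (fun R θ => c R * f R θ) z = c z * kMoment f z := by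
  rw [kMoment_def, kMoment_def, ← MeasureTheory.integral_const_mul]
  exact setIntegral_congr_fun measurableSet_Ioo fun θ _ => by ring

/-- `W_εχ` stays in the orthogonal test class. [folklore] -/
theorem wProfile_mem_orthClass {ε : ℝ} (hε : 0 < ε) {χ : ℝ → ℝ → ℝ} (hχ : χ ∈ orthClass) : wProfile ε χ ∈ orthClass := by
  obtain ⟨hsm, hs, hpos, hχ0, hK⟩ := hχ
  have eu : uncurry (wProfile ε χ) = fun p : ℝ × ℝ => approxWeight ε p.1 * uncurry χ p := by funext p; rfl
  refine ⟨fun n => ?_, ?_, fun p hp => ?_, fun R => ?_, fun R hR => ?_⟩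
  · rw [eu]; exact ((contDiff_approxWeight hε).comp contDiff_fst).mul (hsm n)
  · rw [eu]; exact hs.mul_left
  · rw [eu] at hp; exact hpos p (tsupport_mul_subset_right hp)
  · show approxWeight ε R * χ R 0 = 0; rw [hχ0 R, mul_zero]
  · have e : (fun R θ => Real.cos θ * wProfile ε χ R θ) = fun R θ => approxWeight ε R * (Real.cos θ * χ R θ) := by
      funext R θ; simp only [wProfile]; ring
    rw [e, kMoment_radial_mul, hK R hR, mul_zero]

/-- **`T_ε` on graphs**: `T_ε(Jχ) = J(W_εχ)` for `χ ∈ C¹` compactly supported inside `R > 0`. [folklore] -/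
theorem weightOp_graphElt (α : ℝ) {ε : ℝ} (hε : 0 < ε) {χ : ℝ → ℝ → ℝ} (hχ : ContDiff ℝ 1 (uncurry χ))
    (hs : HasCompactSupport (uncurry χ)) :
    weightOp α hε (graphElt α χ) = graphElt α (wProfile ε χ) := by
  -- the graph components of `W_εχ`
  have cW : Continuous fun p : ℝ × ℝ => approxWeight ε p.1 := (contDiff_approxWeight hε (n := 0)).continuous.comp continuous_fst
  have dzW : ∀ p : ℝ × ℝ, dz (wProfile ε χ) p.1 p.2 = deriv (approxWeight ε) p.1 * χ p.1 p.2 + approxWeight ε p.1 * dz χ p.1 p.2 := by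
    intro p
    show deriv (fun R' => approxWeight ε R' * χ R' p.2) p.1 = _
    have h1 : HasDerivAt (approxWeight ε) (deriv (approxWeight ε) p.1) p.1 :=
      ((contDiff_approxWeight hε (n := 1)).differentiable (by norm_num) p.1).hasDerivAt
    have h2 : HasDerivAt (fun R' => χ R' p.2) (dz χ p.1 p.2) p.1 :=
      (((hχ.comp (contDiff_id.prodMk contDiff_const)).differentiable (by simp)) p.1).hasDerivAt
    have h3 : HasDerivAt (fun R' => approxWeight ε R' * χ R' p.2)
        (deriv (approxWeight ε) p.1 * χ p.1 p.2 + approxWeight ε p.1 * dz χ p.1 p.2) p.1 := h1.mul h2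
    rw [h3.deriv]
  have dθW : ∀ p : ℝ × ℝ, dθ (wProfile ε χ) p.1 p.2 = approxWeight ε p.1 * dθ χ p.1 p.2 := by
    intro p
    show deriv (fun θ' => approxWeight ε p.1 * χ p.1 θ') p.2 = _
    exact deriv_const_mul_field _
  have g0 : graphFn α (wProfile ε χ) 0 = fun p => bW ε p * graphFn α χ 0 p := by
    funext p; show Real.cos p.2 * (approxWeight ε p.1 * χ p.1 p.2) = approxWeight ε p.1 * (Real.cos p.2 * χ p.1 p.2); ring
  have g1 : graphFn α (wProfile ε χ) 1 = fun p => bW ε p * graphFn α χ 1 p + bD α ε p * graphFn α χ 0 p := by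
    funext p
    show α * (p.1 * (Real.cos p.2 * dz (wProfile ε χ) p.1 p.2)) =
      approxWeight ε p.1 * (α * (p.1 * (Real.cos p.2 * dz χ p.1 p.2))) + α * p.1 * deriv (approxWeight ε) p.1 * (Real.cos p.2 * χ p.1 p.2)
    rw [dzW]; ring
  have g2 : graphFn α (wProfile ε χ) 2 = fun p => bW ε p * graphFn α χ 2 p := by
    funext p
    show -Real.sin p.2 * wProfile ε χ p.1 p.2 + Real.cos p.2 * dθ (wProfile ε χ) p.1 p.2 =
      approxWeight ε p.1 * (-Real.sin p.2 * χ p.1 p.2 + Real.cos p.2 * dθ χ p.1 p.2)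
    rw [dθW]; simp only [wProfile]; ring
  have g3 : graphFn α (wProfile ε χ) 3 = fun p => bW ε p * graphFn α χ 3 p := by
    funext p; show Real.sin p.2 * (approxWeight ε p.1 * χ p.1 p.2) = approxWeight ε p.1 * (Real.sin p.2 * χ p.1 p.2); ring
  -- each component as an `L²` identity
  have mW : ∀ k, MemLp (fun p => bW ε p * graphFn α χ k p) 2 stripMeasure := fun k =>
    memLp_strip_of_continuous (cW.mul (continuous_graphFn hχ k)) ((hasCompactSupport_graphFn hs k).mul_left)
  have mD : MemLp (fun p => bD α ε p * graphFn α χ 0 p) 2 stripMeasure := by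
    refine memLp_strip_of_continuous ?_ ((hasCompactSupport_graphFn hs 0).mul_left)
    have cD : Continuous fun p : ℝ × ℝ => deriv (approxWeight ε) p.1 :=
      ((contDiff_approxWeight hε (n := 1)).continuous_deriv le_rfl).comp continuous_fst
    have : Continuous fun p : ℝ × ℝ => bD α ε p := by unfold bD; fun_prop
    exact this.mul (continuous_graphFn hχ 0)
  ext k : 1
  fin_cases k
  · show mulW hε (toL2 (graphFn α χ 0)) = toL2 (graphFn α (wProfile ε χ) 0)
    rw [g0]; exact mulL2_toL2 _ _ (memLp_graphFn hχ hs 0) (mW 0)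
  · show mulW hε (toL2 (graphFn α χ 1)) + mulD α hε (toL2 (graphFn α χ 0)) = toL2 (graphFn α (wProfile ε χ) 1)
    have e : (fun p => bW ε p * graphFn α χ 1 p + bD α ε p * graphFn α χ 0 p) =
        (fun p => bW ε p * graphFn α χ 1 p) + fun p => bD α ε p * graphFn α χ 0 p := by funext p; rfl
    rw [g1, e, toL2_add (mW 1) mD]
    congr 1
    · exact mulL2_toL2 _ _ (memLp_graphFn hχ hs 1) (mW 1)
    · exact mulL2_toL2 _ _ (memLp_graphFn hχ hs 0) mD
  · show mulW hε (toL2 (graphFn α χ 2)) = toL2 (graphFn α (wProfile ε χ) 2)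
    rw [g2]; exact mulL2_toL2 _ _ (memLp_graphFn hχ hs 2) (mW 2)
  · show mulW hε (toL2 (graphFn α χ 3)) = toL2 (graphFn α (wProfile ε χ) 3)
    rw [g3]; exact mulL2_toL2 _ _ (memLp_graphFn hχ hs 3) (mW 3)

/-- **`T_ε` preserves the energy space.** [folklore] -/
theorem weightOp_mem_weakSpace (α : ℝ) {ε : ℝ} (hε : 0 < ε) {U : E4} (hU : U ∈ weakSpace α) : weightOp α hε U ∈ weakSpace α := by
  have hsub : weightOp α hε '' (LinearMap.range (graphL α) : Set E4) ⊆ (LinearMap.range (graphL α) : Set E4) := by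
    rintro _ ⟨_, ⟨χ, rfl⟩, rfl⟩
    refine ⟨⟨wProfile ε χ, wProfile_mem_orthClass hε χ.2⟩, ?_⟩
    rw [graphL_apply, graphL_apply]
    exact (weightOp_graphElt α hε (χ.2.1 1) χ.2.2.1).symm
  have hU' : U ∈ closure ((LinearMap.range (graphL α) : Set E4)) := by
    rw [← Submodule.topologicalClosure_coe]; exact hU
  have h := image_closure_subset_closure_image (weightOp α hε).continuous ⟨U, hU', rfl⟩
  have h' := closure_mono hsub h
  show weightOp α hε U ∈ (weakSpace α : Set E4)
  rw [weakSpace, Submodule.topologicalClosure_coe]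
  exact h'

/-! ### The derivatives `(RW_ε)′ = W_ε·B_ε` and `(R²W_ε)″ = W_ε·A_ε` -/

/-- `B_ε(R) = 1 + 4R/(1+R) − 4R²/(R²+ε)` (`(RW_ε)′ = W_εB_ε`). [folklore] -/
def Bfun (ε R : ℝ) : ℝ := 1 + 4 * (R / (1 + R)) - 4 * (R ^ 2 / (R ^ 2 + ε))

/-- `A_ε = B_ε(1 + B_ε) + 4t(1−t) − 8u(1−u)`, `t = R/(1+R)`, `u = R²/(R²+ε)` (`(R²W_ε)″ = W_εA_ε`). [folklore] -/
def Afun (ε R : ℝ) : ℝ :=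
  Bfun ε R * (1 + Bfun ε R) + (4 * (R / (1 + R)) * (1 - R / (1 + R)) - 8 * (R ^ 2 / (R ^ 2 + ε)) * (1 - R ^ 2 / (R ^ 2 + ε)))

/-- The auxiliary ratios lie in `[0,1]`. [folklore] -/
theorem ratio_mem {ε R : ℝ} (hε : 0 < ε) (hR : 0 ≤ R) :
    0 ≤ R / (1 + R) ∧ R / (1 + R) ≤ 1 ∧ 0 ≤ R ^ 2 / (R ^ 2 + ε) ∧ R ^ 2 / (R ^ 2 + ε) ≤ 1 := by
  refine ⟨by positivity, ?_, by positivity, ?_⟩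
  · rw [div_le_one (by linarith)]; linarith
  · rw [div_le_one (by positivity)]; linarith

/-- `−3 ≤ B_ε ≤ 5` on `R ≥ 0`. [folklore] -/
theorem Bfun_bounds {ε R : ℝ} (hε : 0 < ε) (hR : 0 ≤ R) : -3 ≤ Bfun ε R ∧ Bfun ε R ≤ 5 := by
  obtain ⟨t0, t1, u0, u1⟩ := ratio_mem hε hR
  unfold Bfun; constructor <;> linarith

/-- `−3 ≤ A_ε ≤ 30` on `R ≥ 0`. [folklore] -/
theorem Afun_bounds {ε R : ℝ} (hε : 0 < ε) (hR : 0 ≤ R) : -3 ≤ Afun ε R ∧ Afun ε R ≤ 30 := by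
  obtain ⟨t0, t1, u0, u1⟩ := ratio_mem hε hR
  unfold Afun Bfun
  set t := R / (1 + R)
  set u := R ^ 2 / (R ^ 2 + ε)
  constructor
  · nlinarith [sq_nonneg (48 * u - (20 + 32 * t)), mul_nonneg t0 (sub_nonneg.2 t1)]
  · nlinarith [mul_nonneg u0 (sub_nonneg.2 u1), mul_nonneg t0 (sub_nonneg.2 t1), mul_nonneg u0 t0, mul_nonneg u0 (sub_nonneg.2 t1)]

/-- `(RW_ε)′ = W_ε·B_ε` on `R ≥ 0`. [folklore] -/
theorem hasDerivAt_mul_approxWeight {ε : ℝ} (hε : 0 < ε) {R : ℝ} (hR : 0 ≤ R) :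
    HasDerivAt (fun z => z * approxWeight ε z) (approxWeight ε R * Bfun ε R) R := by
  have h := (hasDerivAt_id R).mul (hasDerivAt_approxWeight hε hR)
  refine h.congr_deriv ?_
  unfold Bfun
  have h1 : (1 + R) ≠ 0 := by linarith
  have h2 : R ^ 2 + ε ≠ 0 := by positivity
  simp only [id]
  field_simp
  ring

/-- The derivative of `B_ε`: `R·B_ε′ = 4t(1−t) − 8u(1−u)`. [folklore] -/
theorem hasDerivAt_Bfun {ε : ℝ} (hε : 0 < ε) {R : ℝ} (hR : 0 ≤ R) :
    HasDerivAt (Bfun ε) (4 / (1 + R) ^ 2 - 8 * R * ε / (R ^ 2 + ε) ^ 2) R := by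
  unfold Bfun
  have h1R : (1 + R) ≠ 0 := by linarith
  have h2R : R ^ 2 + ε ≠ 0 := by positivity
  have d1 : HasDerivAt (fun R : ℝ => R / (1 + R)) (1 / (1 + R) ^ 2) R := by
    have := (hasDerivAt_id R).div ((hasDerivAt_id R).const_add 1) h1R
    refine this.congr_deriv ?_; simp only [id]; field_simp; ring
  have d2 : HasDerivAt (fun R : ℝ => R ^ 2 / (R ^ 2 + ε)) (2 * R * ε / (R ^ 2 + ε) ^ 2) R := by
    have hp : HasDerivAt (fun R : ℝ => R ^ 2) (2 * R) R := by simpa using hasDerivAt_pow 2 R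
    have := hp.div (hp.add_const ε) h2R
    refine this.congr_deriv ?_; field_simp; ring
  have := ((d1.const_mul 4).const_add 1).sub (d2.const_mul 4)
  refine this.congr_deriv ?_; field_simp; ring

/-- `(R²W_ε)′ = RW_ε(1 + B_ε)` on `R ≥ 0`. [folklore] -/
theorem hasDerivAt_sq_mul_approxWeight {ε : ℝ} (hε : 0 < ε) {R : ℝ} (hR : 0 ≤ R) :
    HasDerivAt (fun z => z ^ 2 * approxWeight ε z) (R * approxWeight ε R * (1 + Bfun ε R)) R := by
  have e : (fun z : ℝ => z ^ 2 * approxWeight ε z) = fun z => z * (z * approxWeight ε z) := by funext z; ring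
  rw [e]
  have h := (hasDerivAt_id R).mul (hasDerivAt_mul_approxWeight hε hR)
  refine h.congr_deriv ?_; simp only [id]; ring

/-- `(R²W_ε)″ = W_ε·A_ε` on `R > 0` (as `deriv (deriv ·)`). [folklore] -/
theorem deriv2_sq_mul_approxWeight {ε : ℝ} (hε : 0 < ε) {R : ℝ} (hR : 0 < R) :
    deriv (deriv fun z => z ^ 2 * approxWeight ε z) R = approxWeight ε R * Afun ε R := by
  have e : deriv (fun z => z ^ 2 * approxWeight ε z) =ᶠ[𝓝 R] fun z => z * approxWeight ε z * (1 + Bfun ε z) :=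
    Filter.eventuallyEq_of_mem (Ioi_mem_nhds hR) fun z hz => (hasDerivAt_sq_mul_approxWeight hε (le_of_lt hz)).deriv
  rw [e.deriv_eq]
  have h : HasDerivAt (fun z => z * approxWeight ε z * (1 + Bfun ε z))
      (approxWeight ε R * Bfun ε R * (1 + Bfun ε R) + R * approxWeight ε R * (4 / (1 + R) ^ 2 - 8 * R * ε / (R ^ 2 + ε) ^ 2)) R :=
    (hasDerivAt_mul_approxWeight hε hR.le).mul ((hasDerivAt_Bfun hε hR.le).const_add 1)
  rw [h.deriv]
  unfold Afun
  have h1R : (1 + R) ≠ 0 := by linarith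
  have h2R : R ^ 2 + ε ≠ 0 := by positivity
  have k1 : R * (4 / (1 + R) ^ 2) = 4 * (R / (1 + R)) * (1 - R / (1 + R)) := by field_simp; ring
  have k2 : R * (8 * R * ε / (R ^ 2 + ε) ^ 2) = 8 * (R ^ 2 / (R ^ 2 + ε)) * (1 - R ^ 2 / (R ^ 2 + ε)) := by field_simp; ring
  calc approxWeight ε R * Bfun ε R * (1 + Bfun ε R) + R * approxWeight ε R * (4 / (1 + R) ^ 2 - 8 * R * ε / (R ^ 2 + ε) ^ 2)
      = approxWeight ε R * (Bfun ε R * (1 + Bfun ε R) + (R * (4 / (1 + R) ^ 2) - R * (8 * R * ε / (R ^ 2 + ε) ^ 2))) := by ring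
    _ = _ := by rw [k1, k2]

/-- `(RW_ε)′ = W_εB_ε` as `deriv`. [folklore] -/
theorem deriv_mul_approxWeight {ε : ℝ} (hε : 0 < ε) {R : ℝ} (hR : 0 ≤ R) :
    deriv (fun z => z * approxWeight ε z) R = approxWeight ε R * Bfun ε R := (hasDerivAt_mul_approxWeight hε hR).deriv

/-! ### The quadratic functional `Q_ε` and the identity `B(U, T_εU) = Q_ε(U)` -/

section quadratic

variable (α : ℝ) {ε : ℝ} (hε : 0 < ε)

/-- The `Ψ²`-multiplier `c_ε = W_ε(−(α²/2)A_ε + (α(5+α)/2)B_ε − 11/2)`. [folklore] -/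
def bC (α ε : ℝ) (p : ℝ × ℝ) : ℝ := approxWeight ε p.1 * (-(α ^ 2 / 2) * Afun ε p.1 + α * (5 + α) / 2 * Bfun ε p.1 - 11 / 2)

include hε

/-- `c_ε` is measurable. [folklore] -/
theorem measurable_bC : Measurable (bC α ε) := by
  unfold bC Afun Bfun
  have := (contDiff_approxWeight hε (n := 0)).continuous.measurable
  fun_prop

/-- `c_ε` is bounded on the strip. [folklore] -/
theorem bC_bound : ∀ p ∈ strip, |bC α ε p| ≤ (16 / ε ^ 2 + 16) * (15 * α ^ 2 + |α| * (5 + |α|) / 2 * 5 + 11 / 2) := fun p hp => by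
  have hR : 0 < p.1 := hp.1
  obtain ⟨A1, A2⟩ := Afun_bounds hε hR.le (ε := ε)
  obtain ⟨B1, B2⟩ := Bfun_bounds hε hR.le (ε := ε)
  have hW := approxWeight_pos hε hR.le
  have hWle := approxWeight_le hε hR.le
  unfold bC
  rw [abs_mul, abs_of_pos hW]
  refine mul_le_mul hWle ?_ (abs_nonneg _) (by positivity)
  have hA : |Afun ε p.1| ≤ 30 := abs_le.2 ⟨by linarith, A2⟩
  have hB : |Bfun ε p.1| ≤ 5 := abs_le.2 ⟨by linarith, B2⟩
  have h1 : |-(α ^ 2 / 2) * Afun ε p.1| ≤ 15 * α ^ 2 := by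
    rw [abs_mul, abs_neg, abs_of_nonneg (by positivity : (0:ℝ) ≤ α ^ 2 / 2)]
    nlinarith [sq_nonneg α]
  have h2 : |α * (5 + α) / 2 * Bfun ε p.1| ≤ |α| * (5 + |α|) / 2 * 5 := by
    rw [abs_mul, abs_div, abs_mul, abs_two]
    have : |5 + α| ≤ 5 + |α| := (abs_add_le _ _).trans (by rw [abs_of_pos (by norm_num : (0:ℝ) < 5)])
    have h5 : 0 ≤ |α| * |5 + α| / 2 := by positivity
    calc |α| * |5 + α| / 2 * |Bfun ε p.1| ≤ |α| * |5 + α| / 2 * 5 := by gcongr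
      _ ≤ |α| * (5 + |α|) / 2 * 5 := by gcongr
  calc |-(α ^ 2 / 2) * Afun ε p.1 + α * (5 + α) / 2 * Bfun ε p.1 - 11 / 2|
      ≤ |-(α ^ 2 / 2) * Afun ε p.1 + α * (5 + α) / 2 * Bfun ε p.1| + |(11 / 2 : ℝ)| := abs_sub _ _
    _ ≤ |-(α ^ 2 / 2) * Afun ε p.1| + |α * (5 + α) / 2 * Bfun ε p.1| + |(11 / 2 : ℝ)| := by gcongr; exact abs_add_le _ _
    _ ≤ 15 * α ^ 2 + |α| * (5 + |α|) / 2 * 5 + 11 / 2 := by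
        rw [abs_of_pos (by norm_num : (0:ℝ) < 11 / 2)]; gcongr

/-- Multiplication by `c_ε`. [folklore] -/
def mulC : L2Strip →L[ℝ] L2Strip := mulL2 (measurable_bC α hε) (bC_bound α hε)

/-- **The quadratic functional** `Q_ε(U) = ⟨W_εU₁,U₁⟩ + ⟨c_εU₀,U₀⟩ + ⟨W_εU₂,U₂⟩ + ½⟨W_εU₃,U₃⟩`. [folklore] -/
def quadFun (U : E4) : ℝ :=
  ⟪mulW hε (U 1), U 1⟫_ℝ + ⟪mulC α hε (U 0), U 0⟫_ℝ + ⟪mulW hε (U 2), U 2⟫_ℝ + (1 / 2) * ⟪mulW hε (U 3), U 3⟫_ℝ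

/-- `Q_ε` is continuous. [folklore] -/
theorem continuous_quadFun : Continuous (quadFun α hε) := by
  unfold quadFun
  have hc : ∀ k : Fin 4, Continuous fun U : E4 => U k := fun k => (PiLp.proj 2 (𝕜 := ℝ) (fun _ : Fin 4 => L2Strip) k).continuous
  have hi : ∀ (T : L2Strip →L[ℝ] L2Strip) (k : Fin 4), Continuous fun U : E4 => ⟪T (U k), U k⟫_ℝ := fun T k =>
    (T.continuous.comp (hc k)).inner (hc k)
  exact (((hi _ 1).add (hi _ 0)).add (hi _ 2)).add (continuous_const.mul (hi _ 3))

omit hε in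
/-- `⟨b·(toL2 g), toL2 g⟩ = ∫∫ b g²`. [folklore] -/
theorem inner_mulL2_toL2 {b : ℝ × ℝ → ℝ} (hb : Measurable b) {C : ℝ} (hC : ∀ p ∈ strip, |b p| ≤ C) {g : ℝ × ℝ → ℝ}
    (hg : MemLp g 2 stripMeasure) : ⟪mulL2 hb hC (toL2 g), toL2 g⟫_ℝ = ∫ p in strip, b p * g p ^ 2 := by
  rw [inner_mulL2]
  refine integral_congr_ae ?_
  filter_upwards [toL2_ae_eq' hg] with p hp
  rw [hp]; ring

/-- **The identity on graphs**: `B(Jχ, T_εJχ) = Q_ε(Jχ)` for `χ` in the test class (the weighted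
energy identity `integral_strip_ellipticOp_mul_self_weight` with `W = W_ε`, read through the Green
identity). [cite: Elgindi2021, §7.3 proof of Proposition 7.7, Step 1 (pp. 20–21 of arXiv:1904.04795)] -/
theorem energyForm_weightOp_graphElt {χ : ℝ → ℝ → ℝ} (hχ : χ ∈ orthClass) :
    energyForm α (graphElt α χ) (weightOp α hε (graphElt α χ)) = quadFun α hε (graphElt α χ) := by
  obtain ⟨hWsm, hWs, hWpos, hW0, -⟩ := wProfile_mem_orthClass hε hχ
  obtain ⟨hsm, hs, hpos, hχ0, -⟩ := hχ
  have h2 : ContDiff ℝ 2 (uncurry χ) := hsm 2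
  have h1 : ContDiff ℝ 1 (uncurry χ) := hsm 1
  obtain ⟨Ψ, hΨ⟩ : ∃ Ψ : ℝ → ℝ → ℝ, Ψ = fun R θ => Real.cos θ * χ R θ := ⟨_, rfl⟩
  -- the left-hand side through the Green identity and the weighted energy identity
  have hWC : ContDiffOn ℝ 2 (approxWeight ε) (Ioi 0) := (contDiff_approxWeight hε).contDiffOn
  rw [weightOp_graphElt α hε h1 hs, ← integral_strip_ellipticOp_mul_eq_energyForm α h2 hs hpos (hWsm 1) hWs hWpos hW0 hΨ]
  have eL : ∫ p in strip, ellipticOp α Ψ p.1 p.2 * graphFn α (wProfile ε χ) 0 p =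
      ∫ p in strip, ellipticOp α Ψ p.1 p.2 * Ψ p.1 p.2 * approxWeight ε p.1 := by
    refine integral_congr_ae (ae_of_all _ fun p => ?_)
    show ellipticOp α Ψ p.1 p.2 * (Real.cos p.2 * (approxWeight ε p.1 * χ p.1 p.2)) = _
    rw [hΨ]; ring
  rw [eL, integral_strip_ellipticOp_mul_self_weight α hWC h2 hs hpos hχ0 hΨ]
  -- the right-hand side as strip integrals
  unfold quadFun
  simp only [graphElt_apply]
  rw [show mulW hε = mulL2 (measurable_bW hε) (bW_bound hε) from rfl, show mulC α hε = mulL2 (measurable_bC α hε) (bC_bound α hε) from rfl,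
    inner_mulL2_toL2 _ _ (memLp_graphFn h1 hs 1), inner_mulL2_toL2 _ _ (memLp_graphFn h1 hs 0),
    inner_mulL2_toL2 _ _ (memLp_graphFn h1 hs 2), inner_mulL2_toL2 _ _ (memLp_graphFn h1 hs 3)]
  -- pointwise identifications of the graph components
  have hΨ1 : ContDiff ℝ 1 (uncurry Ψ) := by rw [hΨ]; exact contDiff_cosProfile h1
  have hΨ2 : ContDiff ℝ 2 (uncurry Ψ) := by rw [hΨ]; exact contDiff_cosProfile h2
  have hΨs : HasCompactSupport (uncurry Ψ) := by rw [hΨ]; exact hasCompactSupport_cosProfile hs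
  have g1 : ∀ p : ℝ × ℝ, graphFn α χ 1 p = α * (p.1 * dz Ψ p.1 p.2) := fun p => by
    show α * (p.1 * (Real.cos p.2 * dz χ p.1 p.2)) = _; rw [hΨ, dz_cosProfile h1]
  have g2 : ∀ p : ℝ × ℝ, graphFn α χ 2 p = dθ Ψ p.1 p.2 := fun p => by
    show -Real.sin p.2 * χ p.1 p.2 + Real.cos p.2 * dθ χ p.1 p.2 = _; rw [hΨ, dθ_cosProfile h1]
  have g0 : ∀ p : ℝ × ℝ, graphFn α χ 0 p = Ψ p.1 p.2 := fun p => by rw [hΨ]; rfl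
  have g3 : ∀ p : ℝ × ℝ, graphFn α χ 3 p = Real.sin p.2 * χ p.1 p.2 := fun p => rfl
  -- continuity / compact support of everything in sight
  have cW : Continuous fun p : ℝ × ℝ => approxWeight ε p.1 := (contDiff_approxWeight hε (n := 0)).continuous.comp continuous_fst
  have cM2 : Continuous fun p : ℝ × ℝ => deriv (deriv fun z => z ^ 2 * approxWeight ε z) p.1 := by
    have hsm2 : ContDiff ℝ 2 (fun z : ℝ => z ^ 2 * approxWeight ε z) := (contDiff_id.pow 2).mul (contDiff_approxWeight hε)
    have hd1 : ContDiff ℝ 1 (deriv fun z : ℝ => z ^ 2 * approxWeight ε z) := by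
      have := hsm2.iterate_deriv' 1 1; simpa using this
    exact (hd1.continuous_deriv le_rfl).comp continuous_fst
  have cN1 : Continuous fun p : ℝ × ℝ => deriv (fun z => z * approxWeight ε z) p.1 := by
    have hsm1 : ContDiff ℝ 1 (fun z : ℝ => z * approxWeight ε z) := contDiff_id.mul (contDiff_approxWeight hε)
    exact (hsm1.continuous_deriv le_rfl).comp continuous_fst
  have cΨ : Continuous fun p : ℝ × ℝ => Ψ p.1 p.2 := hΨ1.continuous
  have cχ : Continuous fun p : ℝ × ℝ => χ p.1 p.2 := h1.continuous
  have sΨ2 : HasCompactSupport fun p : ℝ × ℝ => Ψ p.1 p.2 ^ 2 := by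
    have e : (fun p : ℝ × ℝ => Ψ p.1 p.2 ^ 2) = fun p => Ψ p.1 p.2 * Ψ p.1 p.2 := by funext p; ring
    rw [e]; exact hΨs.mul_left
  have sχ2 : HasCompactSupport fun p : ℝ × ℝ => χ p.1 p.2 ^ 2 := by
    have e : (fun p : ℝ × ℝ => χ p.1 p.2 ^ 2) = fun p => χ p.1 p.2 * χ p.1 p.2 := by funext p; ring
    rw [e]; exact hs.mul_left
  have s3 : HasCompactSupport fun p : ℝ × ℝ => graphFn α χ 3 p ^ 2 := by
    have e : (fun p : ℝ × ℝ => graphFn α χ 3 p ^ 2) = fun p => graphFn α χ 3 p * graphFn α χ 3 p := by funext p; ring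
    rw [e]; exact (hasCompactSupport_graphFn hs 3).mul_left
  -- integrability of the pieces (continuous with compact support)
  have iM : IntegrableOn (fun p : ℝ × ℝ => deriv (deriv fun z => z ^ 2 * approxWeight ε z) p.1 * Ψ p.1 p.2 ^ 2) strip :=
    ((cM2.mul (cΨ.pow 2)).integrable_of_hasCompactSupport sΨ2.mul_left).integrableOn
  have iN : IntegrableOn (fun p : ℝ × ℝ => deriv (fun z => z * approxWeight ε z) p.1 * Ψ p.1 p.2 ^ 2) strip :=
    ((cN1.mul (cΨ.pow 2)).integrable_of_hasCompactSupport sΨ2.mul_left).integrableOn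
  have iE : IntegrableOn (fun p : ℝ × ℝ => approxWeight ε p.1 * Ψ p.1 p.2 ^ 2) strip :=
    ((cW.mul (cΨ.pow 2)).integrable_of_hasCompactSupport sΨ2.mul_left).integrableOn
  have i3 : IntegrableOn (fun p : ℝ × ℝ => bW ε p * graphFn α χ 3 p ^ 2) strip := by
    show IntegrableOn (fun p : ℝ × ℝ => approxWeight ε p.1 * graphFn α χ 3 p ^ 2) strip
    exact ((cW.mul ((continuous_graphFn h1 3).pow 2)).integrable_of_hasCompactSupport s3.mul_left).integrableOn
  -- the four quadratic integrals
  have q1 : ∫ p in strip, bW ε p * graphFn α χ 1 p ^ 2 = α ^ 2 * ∫ p in strip, approxWeight ε p.1 * (p.1 * dz Ψ p.1 p.2) ^ 2 := by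
    rw [← MeasureTheory.integral_const_mul]
    refine integral_congr_ae (ae_of_all _ fun p => ?_)
    show approxWeight ε p.1 * graphFn α χ 1 p ^ 2 = _
    rw [g1 p]; ring
  have q2 : ∫ p in strip, bW ε p * graphFn α χ 2 p ^ 2 = ∫ p in strip, approxWeight ε p.1 * dθ Ψ p.1 p.2 ^ 2 := by
    refine integral_congr_ae (ae_of_all _ fun p => ?_)
    show approxWeight ε p.1 * graphFn α χ 2 p ^ 2 = _
    rw [g2 p]
  have q0 : ∫ p in strip, bC α ε p * graphFn α χ 0 p ^ 2 =
      -(α ^ 2 / 2) * (∫ p in strip, deriv (deriv fun z => z ^ 2 * approxWeight ε z) p.1 * Ψ p.1 p.2 ^ 2) +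
        α * (5 + α) / 2 * (∫ p in strip, deriv (fun z => z * approxWeight ε z) p.1 * Ψ p.1 p.2 ^ 2) -
        11 / 2 * (∫ p in strip, approxWeight ε p.1 * Ψ p.1 p.2 ^ 2) := by
    have e : ∫ p in strip, bC α ε p * graphFn α χ 0 p ^ 2 = ∫ p in strip,
        (-(α ^ 2 / 2) * (deriv (deriv fun z => z ^ 2 * approxWeight ε z) p.1 * Ψ p.1 p.2 ^ 2) +
          α * (5 + α) / 2 * (deriv (fun z => z * approxWeight ε z) p.1 * Ψ p.1 p.2 ^ 2) -
          11 / 2 * (approxWeight ε p.1 * Ψ p.1 p.2 ^ 2)) := by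
      refine setIntegral_congr_fun measurableSet_strip fun p hp => ?_
      have hR : 0 < p.1 := hp.1
      show bC α ε p * graphFn α χ 0 p ^ 2 = _
      rw [g0 p, deriv2_sq_mul_approxWeight hε hR, deriv_mul_approxWeight hε hR.le]
      unfold bC
      ring
    rw [e, integral_sub, integral_add, MeasureTheory.integral_const_mul, MeasureTheory.integral_const_mul,
      MeasureTheory.integral_const_mul]
    all_goals first
      | exact iM.const_mul _
      | exact iN.const_mul _
      | exact (iM.const_mul _).add (iN.const_mul _)
      | exact iE.const_mul _
  have q3 : ∫ p in strip, approxWeight ε p.1 * χ p.1 p.2 ^ 2 =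
      (∫ p in strip, approxWeight ε p.1 * Ψ p.1 p.2 ^ 2) + ∫ p in strip, bW ε p * graphFn α χ 3 p ^ 2 := by
    have e : ∫ p in strip, approxWeight ε p.1 * χ p.1 p.2 ^ 2 =
        ∫ p in strip, (approxWeight ε p.1 * Ψ p.1 p.2 ^ 2 + bW ε p * graphFn α χ 3 p ^ 2) := by
      refine integral_congr_ae (ae_of_all _ fun p => ?_)
      show approxWeight ε p.1 * χ p.1 p.2 ^ 2 = approxWeight ε p.1 * Ψ p.1 p.2 ^ 2 + approxWeight ε p.1 * (Real.sin p.2 * χ p.1 p.2) ^ 2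
      rw [hΨ]
      have := Real.sin_sq_add_cos_sq p.2
      linear_combination (-(approxWeight ε p.1 * χ p.1 p.2 ^ 2)) * this
    rw [e, integral_add iE i3]
  rw [q1, q2, q0, q3]
  ring

set_option maxHeartbeats 4000000 in
/-- **`B(U, T_εU) = Q_ε(U)` on the energy space** (closure of the graph identity). [folklore] -/
theorem energyForm_weightOp {U : E4} (hU : U ∈ weakSpace α) : energyForm α U (weightOp α hε U) = quadFun α hε U := by
  have hcl : IsClosed {U : E4 | energyForm α U (weightOp α hε U) = quadFun α hε U} := by
    refine isClosed_eq ?_ (continuous_quadFun α hε)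
    have h1 : Continuous fun p : E4 × E4 => energyForm α p.1 p.2 := (energyForm α).continuous₂
    exact h1.comp (continuous_id.prodMk (weightOp α hε).continuous)
  have hsub : (LinearMap.range (graphL α) : Set E4) ⊆ {U : E4 | energyForm α U (weightOp α hε U) = quadFun α hε U} := by
    rintro U ⟨χ, rfl⟩
    exact energyForm_weightOp_graphElt α hε χ.2
  have hU' : U ∈ closure ((LinearMap.range (graphL α) : Set E4)) := by
    rw [← Submodule.topologicalClosure_coe]; exact hU
  exact closure_minimal hsub hcl hU'

/-! ### The weighted Poincaré inequality on the energy space -/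

/-- **`12∫∫W_εΨ² ≤ ∫∫W_ε(∂_θΨ)²` on graphs** (slice by slice `orthogonalMode_poincare`, times
`W_ε(R) ≥ 0`). [cite: Elgindi2021, §7.1 proof of Proposition 7.1, Step 2 (pp. 19–20 of arXiv:1904.04795)] -/
theorem weightedPoincare_graphElt {χ : ℝ → ℝ → ℝ} (hχ : χ ∈ orthClass) :
    12 * ⟪mulW hε (graphElt α χ 0), graphElt α χ 0⟫_ℝ ≤ ⟪mulW hε (graphElt α χ 2), graphElt α χ 2⟫_ℝ := by
  obtain ⟨hsm, hs, hpos, hχ0, hK⟩ := hχ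
  have h2 : ContDiff ℝ 2 (uncurry χ) := hsm 2
  have h1 : ContDiff ℝ 1 (uncurry χ) := hsm 1
  simp only [graphElt_apply]
  rw [show mulW hε = mulL2 (measurable_bW hε) (bW_bound hε) from rfl,
    inner_mulL2_toL2 _ _ (memLp_graphFn h1 hs 0), inner_mulL2_toL2 _ _ (memLp_graphFn h1 hs 2)]
  obtain ⟨Ψ, hΨ⟩ : ∃ Ψ : ℝ → ℝ → ℝ, Ψ = fun R θ => Real.cos θ * χ R θ := ⟨_, rfl⟩
  have g2 : ∀ p : ℝ × ℝ, graphFn α χ 2 p = dθ Ψ p.1 p.2 := fun p => by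
    show -Real.sin p.2 * χ p.1 p.2 + Real.cos p.2 * dθ χ p.1 p.2 = _; rw [hΨ, dθ_cosProfile h1]
  have g0 : ∀ p : ℝ × ℝ, graphFn α χ 0 p = Ψ p.1 p.2 := fun p => by rw [hΨ]; rfl
  simp only [g0, g2]
  have hΨ2 : ContDiff ℝ 2 (uncurry Ψ) := by rw [hΨ]; exact contDiff_cosProfile h2
  have hΨs : HasCompactSupport (uncurry Ψ) := by rw [hΨ]; exact hasCompactSupport_cosProfile hs
  have hdθΨ : ContDiff ℝ 1 (uncurry (dθ Ψ)) := contDiff_dθ_of_contDiff (n := 1) hΨ2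
  have hdθΨs : HasCompactSupport (uncurry (dθ Ψ)) := hasCompactSupport_dθ_of hΨs
  have hD0 : ∀ R, Ψ R 0 = 0 := fun R => by rw [hΨ]; simp [hχ0 R]
  have hD1 : ∀ R, Ψ R (π / 2) = 0 := fun R => by rw [hΨ]; simp
  have hKΨ : ∀ R, 0 < R → kMoment Ψ R = 0 := fun R hR => by rw [hΨ]; exact hK R hR
  have cW : Continuous fun p : ℝ × ℝ => bW ε p := (contDiff_approxWeight hε (n := 0)).continuous.comp continuous_fst
  have cΨ : Continuous fun p : ℝ × ℝ => Ψ p.1 p.2 := hΨ2.continuous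
  have cdθ : Continuous fun p : ℝ × ℝ => dθ Ψ p.1 p.2 := hdθΨ.continuous
  have sE : HasCompactSupport fun p : ℝ × ℝ => Ψ p.1 p.2 ^ 2 := by
    have : (fun p : ℝ × ℝ => Ψ p.1 p.2 ^ 2) = fun p : ℝ × ℝ => Ψ p.1 p.2 * Ψ p.1 p.2 := by funext p; ring
    rw [this]; exact hΨs.mul_left
  have sY : HasCompactSupport fun p : ℝ × ℝ => dθ Ψ p.1 p.2 ^ 2 := by
    have : (fun p : ℝ × ℝ => dθ Ψ p.1 p.2 ^ 2) = fun p : ℝ × ℝ => dθ Ψ p.1 p.2 * dθ Ψ p.1 p.2 := by funext p; ring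
    rw [this]; exact hdθΨs.mul_left
  have iE : Integrable fun p : ℝ × ℝ => bW ε p * Ψ p.1 p.2 ^ 2 := (cW.mul (cΨ.pow 2)).integrable_of_hasCompactSupport sE.mul_left
  have iY : Integrable fun p : ℝ × ℝ => bW ε p * dθ Ψ p.1 p.2 ^ 2 := (cW.mul (cdθ.pow 2)).integrable_of_hasCompactSupport sY.mul_left
  have iG : Integrable fun p : ℝ × ℝ => bW ε p * dθ Ψ p.1 p.2 ^ 2 - 12 * (bW ε p * Ψ p.1 p.2 ^ 2) := iY.sub (iE.const_mul _)
  have hslice : ∀ R ∈ Ioi (0 : ℝ), 0 ≤ ∫ θ in Ioo 0 (π / 2), (bW ε (R, θ) * dθ Ψ R θ ^ 2 - 12 * (bW ε (R, θ) * Ψ R θ ^ 2)) := by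
    intro R hR
    have hRpos : 0 < R := hR
    have huR : ContDiff ℝ 1 fun θ => Ψ R θ := (hΨ2.comp (contDiff_const.prodMk contDiff_id)).of_le (by norm_num)
    have hdu : deriv (fun θ => Ψ R θ) = fun θ => dθ Ψ R θ := rfl
    have horthR : ∫ x in (0 : ℝ)..(π / 2), Ψ R x * (Real.sin x * Real.cos x ^ 2) = 0 := by
      have h := hKΨ R hR
      rw [kMoment_def] at h
      have e : ∫ θ in Ioo 0 (π / 2), Ψ R θ * kernelK θ = 3 * ∫ θ in Ioo 0 (π / 2), Ψ R θ * (Real.sin θ * Real.cos θ ^ 2) := by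
        rw [← MeasureTheory.integral_const_mul]
        refine setIntegral_congr_fun measurableSet_Ioo fun θ _ => ?_
        unfold kernelK; ring
      rw [e] at h
      rw [intervalIntegral.integral_of_le (by positivity), integral_Ioc_eq_integral_Ioo]
      linarith
    have hP := orthogonalMode_poincare huR (hD0 R) (hD1 R) horthR
    rw [hdu] at hP
    rw [intervalIntegral.integral_of_le (by positivity), intervalIntegral.integral_of_le (by positivity),
      integral_Ioc_eq_integral_Ioo, integral_Ioc_eq_integral_Ioo] at hP
    have cu : Continuous fun θ => Ψ R θ := cΨ.comp (Continuous.prodMk_right R)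
    have cdu : Continuous fun θ => dθ Ψ R θ := cdθ.comp (Continuous.prodMk_right R)
    have j1 : IntegrableOn (fun θ => dθ Ψ R θ ^ 2) (Ioo 0 (π / 2)) :=
      ((cdu.pow 2).continuousOn.integrableOn_Icc (a := 0) (b := π / 2)).mono_set Ioo_subset_Icc_self
    have j2 : IntegrableOn (fun θ => Ψ R θ ^ 2) (Ioo 0 (π / 2)) :=
      ((cu.pow 2).continuousOn.integrableOn_Icc (a := 0) (b := π / 2)).mono_set Ioo_subset_Icc_self
    have eW : ∀ θ, bW ε (R, θ) = approxWeight ε R := fun θ => rfl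
    simp only [eW]
    have e2 : ∫ θ in Ioo 0 (π / 2), (approxWeight ε R * dθ Ψ R θ ^ 2 - 12 * (approxWeight ε R * Ψ R θ ^ 2)) =
        approxWeight ε R * ((∫ θ in Ioo 0 (π / 2), dθ Ψ R θ ^ 2) - 12 * ∫ θ in Ioo 0 (π / 2), Ψ R θ ^ 2) := by
      have e3 : ∫ θ in Ioo 0 (π / 2), (approxWeight ε R * dθ Ψ R θ ^ 2 - 12 * (approxWeight ε R * Ψ R θ ^ 2)) =
          ∫ θ in Ioo 0 (π / 2), approxWeight ε R * (dθ Ψ R θ ^ 2 - 12 * Ψ R θ ^ 2) := by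
        refine setIntegral_congr_fun measurableSet_Ioo fun θ _ => ?_; ring
      rw [e3, MeasureTheory.integral_const_mul, integral_sub j1 (j2.const_mul _), MeasureTheory.integral_const_mul]
    rw [e2]
    exact mul_nonneg (approxWeight_pos hε hRpos.le).le (by simp only at hP; linarith)
  have h0 : 0 ≤ ∫ p in strip, (bW ε p * dθ Ψ p.1 p.2 ^ 2 - 12 * (bW ε p * Ψ p.1 p.2 ^ 2)) := by
    rw [integral_strip_eq_integral_Ioi_integral_Ioo iG]
    exact setIntegral_nonneg measurableSet_Ioi hslice
  rw [integral_sub iY.integrableOn (iE.const_mul _).integrableOn, MeasureTheory.integral_const_mul] at h0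
  linarith

set_option maxHeartbeats 4000000 in
/-- **The weighted Poincaré inequality on the energy space.** [folklore] -/
theorem weightedPoincare {U : E4} (hU : U ∈ weakSpace α) : 12 * ⟪mulW hε (U 0), U 0⟫_ℝ ≤ ⟪mulW hε (U 2), U 2⟫_ℝ := by
  have hc : ∀ k : Fin 4, Continuous fun U : E4 => U k := fun k => (PiLp.proj 2 (𝕜 := ℝ) (fun _ : Fin 4 => L2Strip) k).continuous
  have hi : ∀ k : Fin 4, Continuous fun U : E4 => ⟪mulW hε (U k), U k⟫_ℝ := fun k => ((mulW hε).continuous.comp (hc k)).inner (hc k)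
  have hcl : IsClosed {U : E4 | 12 * ⟪mulW hε (U 0), U 0⟫_ℝ ≤ ⟪mulW hε (U 2), U 2⟫_ℝ} :=
    isClosed_le (continuous_const.mul (hi 0)) (hi 2)
  have hsub : (LinearMap.range (graphL α) : Set E4) ⊆ {U : E4 | 12 * ⟪mulW hε (U 0), U 0⟫_ℝ ≤ ⟪mulW hε (U 2), U 2⟫_ℝ} := by
    rintro U ⟨χ, rfl⟩
    exact weightedPoincare_graphElt α hε χ.2
  have hU' : U ∈ closure ((LinearMap.range (graphL α) : Set E4)) := by
    rw [← Submodule.topologicalClosure_coe]; exact hU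
  exact closure_minimal hsub hcl hU'

end quadratic

/-! ### Coercivity of `Q_ε` and the uniform weighted bound -/

/-- `⟨W_εu, u⟩ ≥ 0`. [folklore] -/
theorem inner_mulW_nonneg {ε : ℝ} (hε : 0 < ε) (u : L2Strip) : 0 ≤ ⟪mulW hε u, u⟫_ℝ := by
  rw [show mulW hε = mulL2 (measurable_bW hε) (bW_bound hε) from rfl, inner_mulL2]
  refine setIntegral_nonneg measurableSet_strip fun p hp => ?_
  have hW := approxWeight_pos hε (le_of_lt (show 0 < p.1 from hp.1))
  have : bW ε p = approxWeight ε p.1 := rfl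
  rw [this, mul_assoc]
  exact mul_nonneg hW.le (mul_self_nonneg _)

/-- **Coercivity**: for `0 < α ≤ 1/4` and `U` in the energy space,
`⟨W U₁,U₁⟩ + (1/16)⟨W U₂,U₂⟩ + 2⟨W U₀,U₀⟩ + ½⟨W U₃,U₃⟩ ≤ Q_ε(U)`. [folklore] -/
theorem quadFun_coercive {α : ℝ} (hα : 0 < α) (hα4 : α ≤ 1 / 4) {ε : ℝ} (hε : 0 < ε) {U : E4} (hU : U ∈ weakSpace α) :
    ⟪mulW hε (U 1), U 1⟫_ℝ + (1 / 16) * ⟪mulW hε (U 2), U 2⟫_ℝ + 2 * ⟪mulW hε (U 0), U 0⟫_ℝ + (1 / 2) * ⟪mulW hε (U 3), U 3⟫_ℝ ≤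
      quadFun α hε U := by
  have hP := weightedPoincare α hε hU
  -- `c_ε ≥ −(37/4)W_ε` pointwise on the strip
  have hC : ⟪mulL2 (measurable_bW hε) (bW_bound hε) (U 0), U 0⟫_ℝ * (-(37 / 4)) ≤ ⟪mulC α hε (U 0), U 0⟫_ℝ := by
    have hb : Measurable fun p => -(37 / 4) * bW ε p := (measurable_bW hε).const_mul _
    have hbC : ∀ p ∈ strip, |-(37 / 4) * bW ε p| ≤ 37 / 4 * (16 / ε ^ 2 + 16) := fun p hp => by
      rw [abs_mul, abs_neg, abs_of_pos (by norm_num : (0:ℝ) < 37 / 4)]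
      exact mul_le_mul_of_nonneg_left (bW_bound hε p hp) (by norm_num)
    have hle : ∀ p ∈ strip, -(37 / 4) * bW ε p ≤ bC α ε p := fun p hp => by
      have hR : 0 < p.1 := hp.1
      obtain ⟨A1, A2⟩ := Afun_bounds hε hR.le (ε := ε)
      obtain ⟨B1, B2⟩ := Bfun_bounds hε hR.le (ε := ε)
      have hW := approxWeight_pos hε hR.le
      show -(37 / 4) * approxWeight ε p.1 ≤ approxWeight ε p.1 * (-(α ^ 2 / 2) * Afun ε p.1 + α * (5 + α) / 2 * Bfun ε p.1 - 11 / 2)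
      rw [show -(37 / 4) * approxWeight ε p.1 = approxWeight ε p.1 * (-(37 / 4)) by ring]
      refine mul_le_mul_of_nonneg_left ?_ hW.le
      nlinarith [mul_nonneg (sq_nonneg α) (by linarith : (0:ℝ) ≤ 30 - Afun ε p.1),
        mul_nonneg (mul_nonneg hα.le (by linarith : (0:ℝ) ≤ 5 + α)) (by linarith : (0:ℝ) ≤ Bfun ε p.1 + 3)]
    have hmono := inner_mulL2_mono hb (measurable_bC α hε) hbC (bC_bound α hε) hle (U 0)
    have e : ⟪mulL2 hb hbC (U 0), U 0⟫_ℝ = -(37 / 4) * ⟪mulL2 (measurable_bW hε) (bW_bound hε) (U 0), U 0⟫_ℝ := by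
      rw [inner_mulL2, inner_mulL2, ← MeasureTheory.integral_const_mul]
      refine integral_congr_ae (ae_of_all _ fun p => ?_); ring
    rw [e] at hmono
    show ⟪mulL2 (measurable_bW hε) (bW_bound hε) (U 0), U 0⟫_ℝ * (-(37 / 4)) ≤ ⟪mulL2 (measurable_bC α hε) (bC_bound α hε) (U 0), U 0⟫_ℝ
    linarith
  have hW0 := inner_mulW_nonneg hε (U 0)
  have e0 : ⟪mulL2 (measurable_bW hε) (bW_bound hε) (U 0), U 0⟫_ℝ = ⟪mulW hε (U 0), U 0⟫_ℝ := rfl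
  rw [e0] at hC
  unfold quadFun
  linarith

/-- `⟨W_εu, u⟩ = ∫∫ W_ε u²`. [folklore] -/
theorem inner_mulW_eq {ε : ℝ} (hε : 0 < ε) (u : L2Strip) :
    ⟪mulW hε u, u⟫_ℝ = ∫ p in strip, approxWeight ε p.1 * (u : ℝ × ℝ → ℝ) p ^ 2 := by
  rw [show mulW hε = mulL2 (measurable_bW hε) (bW_bound hε) from rfl, inner_mulL2]
  refine integral_congr_ae (ae_of_all _ fun p => ?_)
  show approxWeight ε p.1 * _ * _ = _; ring

/-- **The weighted bound at level `ε`**: for the weak solution `U` (`B(U,·) = ⟨F,·₀⟩` on the energy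
space), `0 < α ≤ 1/4`, and `∫∫ W_εF² ≤ M`:
`⟨WU₁,U₁⟩ + (1/16)⟨WU₂,U₂⟩ + ⟨WU₀,U₀⟩ + ½⟨WU₃,U₃⟩ ≤ M/4` (`W = W_ε`). [cite: Elgindi2021, §7.1 Proposition 7.1 (p. 19 of arXiv:1904.04795)] -/
theorem weightedBound_eps {α : ℝ} (hα : 0 < α) (hα4 : α ≤ 1 / 4) {ε : ℝ} (hε : 0 < ε) {F : L2Strip} {U : E4}
    (hU : U ∈ weakSpace α) (hw : ∀ Φ ∈ weakSpace α, energyForm α U Φ = ⟪F, Φ 0⟫_ℝ) {M : ℝ}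
    (hFM : ∫ p in strip, approxWeight ε p.1 * (F : ℝ × ℝ → ℝ) p ^ 2 ≤ M) :
    ⟪mulW hε (U 1), U 1⟫_ℝ + (1 / 16) * ⟪mulW hε (U 2), U 2⟫_ℝ + ⟪mulW hε (U 0), U 0⟫_ℝ + (1 / 2) * ⟪mulW hε (U 3), U 3⟫_ℝ ≤ M / 4 := by
  have hco := quadFun_coercive hα hα4 hε hU
  have hq : quadFun α hε U = ⟪F, mulW hε (U 0)⟫_ℝ := by
    rw [← energyForm_weightOp α hε hU, hw _ (weightOp_mem_weakSpace α hε hU)]; rfl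
  -- `⟨F, W U₀⟩ ≤ ¼∫∫W F² + ∫∫ W U₀²`
  have hW : ∀ p ∈ strip, 0 ≤ approxWeight ε p.1 := fun p hp => (approxWeight_pos hε (le_of_lt (show 0 < p.1 from hp.1))).le
  set u : ℝ × ℝ → ℝ := (U 0 : ℝ × ℝ → ℝ) with hu
  set f : ℝ × ℝ → ℝ := (F : ℝ × ℝ → ℝ) with hf
  have mF : MemLp f 2 stripMeasure := Lp.memLp F
  have mU : MemLp u 2 stripMeasure := Lp.memLp (U 0)
  have mWU : MemLp (fun p => bW ε p * u p) 2 stripMeasure := memLp_mul_of_bound (measurable_bW hε) (bW_bound hε) (U 0)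
  have mWF : MemLp (fun p => bW ε p * f p) 2 stripMeasure := memLp_mul_of_bound (measurable_bW hε) (bW_bound hε) F
  have iFWU : Integrable (fun p => f p * (bW ε p * u p)) stripMeasure := mF.integrable_mul mWU
  have iWF2 : Integrable (fun p => bW ε p * f p * f p) stripMeasure := mWF.integrable_mul mF
  have iWU2 : Integrable (fun p => bW ε p * u p * u p) stripMeasure := mWU.integrable_mul mU
  have hinner : ⟪F, mulW hε (U 0)⟫_ℝ = ∫ p in strip, f p * (bW ε p * u p) := by
    rw [inner_L2Strip]
    refine integral_congr_ae ?_
    filter_upwards [mulL2_ae_eq (measurable_bW hε) (bW_bound hε) (U 0)] with p hp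
    rw [show (mulW hε (U 0) : ℝ × ℝ → ℝ) p = (mulL2 (measurable_bW hε) (bW_bound hε) (U 0) : ℝ × ℝ → ℝ) p from rfl, hp]
  have hCS : ∫ p in strip, f p * (bW ε p * u p) ≤ (1 / 4) * (∫ p in strip, bW ε p * f p * f p) + ∫ p in strip, bW ε p * u p * u p := by
    rw [← MeasureTheory.integral_const_mul, ← integral_add]
    · refine setIntegral_mono_on iFWU ?_ measurableSet_strip fun p hp => ?_
      · exact ((iWF2.const_mul _).add iWU2)
      · have h0 := hW p hp
        have : bW ε p = approxWeight ε p.1 := rfl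
        rw [this]
        nlinarith [mul_nonneg h0 (sq_nonneg (f p / 2 - u p))]
    · exact (iWF2.const_mul _)
    · exact iWU2
  have e1 : ∫ p in strip, bW ε p * f p * f p = ∫ p in strip, approxWeight ε p.1 * f p ^ 2 :=
    integral_congr_ae (ae_of_all _ fun p => by show approxWeight ε p.1 * f p * f p = _; ring)
  have e2 : ∫ p in strip, bW ε p * u p * u p = ⟪mulW hε (U 0), U 0⟫_ℝ := by
    rw [inner_mulW_eq]
    exact integral_congr_ae (ae_of_all _ fun p => by show approxWeight ε p.1 * u p * u p = _; ring)
  rw [e1, e2] at hCS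
  rw [hq, hinner] at hco
  linarith

/-- `∫∫ W_ε F² ≤ ∫∫ w⁴F²`… precisely `∫∫ W_εF² ≤ ∫∫ (radialWeight R)²F²` when the latter converges. [folklore] -/
theorem integral_approxWeight_sq_le {ε : ℝ} (hε : 0 < ε) (F : L2Strip)
    (hF : IntegrableOn (fun p => radialWeight p.1 ^ 2 * (F : ℝ × ℝ → ℝ) p ^ 2) strip) :
    ∫ p in strip, approxWeight ε p.1 * (F : ℝ × ℝ → ℝ) p ^ 2 ≤ ∫ p in strip, radialWeight p.1 ^ 2 * (F : ℝ × ℝ → ℝ) p ^ 2 := by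
  have mWF : MemLp (fun p => bW ε p * (F : ℝ × ℝ → ℝ) p) 2 stripMeasure := memLp_mul_of_bound (measurable_bW hε) (bW_bound hε) F
  have i1 : Integrable (fun p => bW ε p * (F : ℝ × ℝ → ℝ) p * (F : ℝ × ℝ → ℝ) p) stripMeasure := mWF.integrable_mul (Lp.memLp F)
  have i1' : IntegrableOn (fun p => approxWeight ε p.1 * (F : ℝ × ℝ → ℝ) p ^ 2) strip :=
    i1.congr (ae_of_all _ fun p => by show approxWeight ε p.1 * _ * _ = _; ring)
  refine setIntegral_mono_on i1' hF measurableSet_strip fun p hp => ?_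
  exact mul_le_mul_of_nonneg_right (approxWeight_le_radialWeight_sq hε hp.1) (sq_nonneg _)

/-- **The radially weighted energy bound for the weak solution** (`0 < α ≤ 1/4`): if
`∫∫ w²F² < ∞` (`w = (1+R)²/R²`), then every component of the weak solution `U` satisfies
`∫∫ w²U_k² ≤ 4∫∫ w²F²` (in particular `w U₀, w U₁ = wαR∂_RΨ, w U₂ = w∂_θΨ, w U₃ = w tan θΨ ∈ L²`).
[cite: Elgindi2021, §7.1 Proposition 7.1 with the weight of §1.7.2 (pp. 7, 19 of arXiv:1904.04795)] -/
theorem weightedEnergy_le {α : ℝ} (hα : 0 < α) (hα4 : α ≤ 1 / 4) {F : L2Strip} {U : E4}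
    (hU : U ∈ weakSpace α) (hw : ∀ Φ ∈ weakSpace α, energyForm α U Φ = ⟪F, Φ 0⟫_ℝ)
    (hF : IntegrableOn (fun p => radialWeight p.1 ^ 2 * (F : ℝ × ℝ → ℝ) p ^ 2) strip) (k : Fin 4) :
    IntegrableOn (fun p => radialWeight p.1 ^ 2 * (U k : ℝ × ℝ → ℝ) p ^ 2) strip ∧
      ∫ p in strip, radialWeight p.1 ^ 2 * (U k : ℝ × ℝ → ℝ) p ^ 2 ≤ 16 * ∫ p in strip, radialWeight p.1 ^ 2 * (F : ℝ × ℝ → ℝ) p ^ 2 := by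
  set M := ∫ p in strip, radialWeight p.1 ^ 2 * (F : ℝ × ℝ → ℝ) p ^ 2 with hM
  have hM0 : 0 ≤ M := setIntegral_nonneg measurableSet_strip fun p _ => mul_nonneg (sq_nonneg _) (sq_nonneg _)
  set u : ℝ × ℝ → ℝ := (U k : ℝ × ℝ → ℝ) with hu
  -- the uniform bound `∫∫ W_ε u² ≤ 16·(M/4) = 4M`
  have hbound : ∀ {ε : ℝ} (hε : 0 < ε), ∫ p in strip, approxWeight ε p.1 * u p ^ 2 ≤ 4 * M := by
    intro ε hε
    have h := weightedBound_eps hα hα4 hε hU hw (integral_approxWeight_sq_le hε F hF)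
    have n0 := inner_mulW_nonneg hε (U 0); have n1 := inner_mulW_nonneg hε (U 1)
    have n2 := inner_mulW_nonneg hε (U 2); have n3 := inner_mulW_nonneg hε (U 3)
    have hk : ⟪mulW hε (U k), U k⟫_ℝ ≤ 4 * M := by
      rw [← hM] at h
      fin_cases k
      · show ⟪mulW hε (U 0), U 0⟫_ℝ ≤ 4 * M; linarith
      · show ⟪mulW hε (U 1), U 1⟫_ℝ ≤ 4 * M; linarith
      · show ⟪mulW hε (U 2), U 2⟫_ℝ ≤ 4 * M; linarith
      · show ⟪mulW hε (U 3), U 3⟫_ℝ ≤ 4 * M; linarith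
    rw [inner_mulW_eq] at hk
    exact hk
  -- measurability
  have hum : AEStronglyMeasurable u (volume.restrict strip) := (Lp.memLp (U k)).1
  have hmeas : ∀ ε : ℝ, 0 < ε → AEMeasurable (fun p => ENNReal.ofReal (approxWeight ε p.1 * u p ^ 2)) (volume.restrict strip) :=
    fun ε hε => ((((contDiff_approxWeight hε (n := 0)).continuous.measurable.comp measurable_fst).aemeasurable.mul
      (hum.aemeasurable.pow_const 2))).ennreal_ofReal
  -- integrability of `W_ε u²`
  have hint : ∀ {ε : ℝ} (hε : 0 < ε), IntegrableOn (fun p => approxWeight ε p.1 * u p ^ 2) strip := fun {ε} hε => by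
    have mWU : MemLp (fun p => bW ε p * u p) 2 stripMeasure := memLp_mul_of_bound (measurable_bW hε) (bW_bound hε) (U k)
    have i1 : Integrable (fun p => bW ε p * u p * u p) stripMeasure := mWU.integrable_mul (Lp.memLp (U k))
    exact i1.congr (ae_of_all _ fun p => by show approxWeight ε p.1 * _ * _ = _; ring)
  -- the lintegrals are bounded by `4M`
  have hlin : ∀ {ε : ℝ} (hε : 0 < ε), ∫⁻ p in strip, ENNReal.ofReal (approxWeight ε p.1 * u p ^ 2) ≤ ENNReal.ofReal (4 * M) := by
    intro ε hε
    rw [← ofReal_integral_eq_lintegral_ofReal (hint hε)]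
    · exact ENNReal.ofReal_le_ofReal (hbound hε)
    · rw [Filter.EventuallyLE, ae_restrict_iff' measurableSet_strip]
      exact ae_of_all _ fun p hp => mul_nonneg (approxWeight_pos hε (le_of_lt (show 0 < p.1 from hp.1))).le (sq_nonneg _)
  -- monotone convergence along `ε_n = 1/(n+1)`
  set G : ℕ → ℝ × ℝ → ℝ≥0∞ := fun n p => ENNReal.ofReal (approxWeight (1 / ((n:ℝ) + 1)) p.1 * u p ^ 2) with hG
  have hεn : ∀ n : ℕ, (0:ℝ) < 1 / ((n:ℝ) + 1) := fun n => by positivity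
  have hGm : ∀ n, AEMeasurable (G n) (volume.restrict strip) := fun n => hmeas _ (hεn n)
  have hGmono : ∀ᵐ p ∂(volume.restrict strip), Monotone fun n => G n p := by
    refine ae_of_all _ fun p => fun m n hmn => ?_
    refine ENNReal.ofReal_le_ofReal (mul_le_mul_of_nonneg_right ?_ (sq_nonneg _))
    refine approxWeight_mono (hεn n) ?_ p.1
    have hmn' : (m:ℝ) ≤ n := by exact_mod_cast hmn
    exact one_div_le_one_div_of_le (by positivity) (by linarith)
  have hGlim : ∀ᵐ p ∂(volume.restrict strip), Tendsto (fun n => G n p) atTop (𝓝 (ENNReal.ofReal (radialWeight p.1 ^ 2 * u p ^ 2))) := by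
    rw [ae_restrict_iff' measurableSet_strip]
    refine ae_of_all _ fun p hp => ?_
    have hR : 0 < p.1 := hp.1
    have ht : Tendsto (fun n : ℕ => 1 / ((n:ℝ) + 1)) atTop (𝓝[>] 0) := by
      refine tendsto_nhdsWithin_iff.2 ⟨tendsto_one_div_add_atTop_nhds_zero_nat, Filter.Eventually.of_forall fun n => hεn n⟩
    have h1 := (tendsto_approxWeight hR).comp ht
    exact ENNReal.tendsto_ofReal ((h1.mul_const (u p ^ 2)))
  have hconv := lintegral_tendsto_of_tendsto_of_monotone hGm hGmono hGlim
  have hle : ∫⁻ p in strip, ENNReal.ofReal (radialWeight p.1 ^ 2 * u p ^ 2) ≤ ENNReal.ofReal (4 * M) :=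
    le_of_tendsto' hconv fun n => hlin (hεn n)
  -- conclude
  have hmeasL : AEStronglyMeasurable (fun p => radialWeight p.1 ^ 2 * u p ^ 2) (volume.restrict strip) := by
    have hw : AEMeasurable (fun p : ℝ × ℝ => radialWeight p.1 ^ 2) (volume.restrict strip) := by
      have : Measurable fun p : ℝ × ℝ => radialWeight p.1 ^ 2 := by unfold radialWeight; fun_prop
      exact this.aemeasurable
    exact (hw.mul (hum.aemeasurable.pow_const 2)).aestronglyMeasurable
  have hnn : 0 ≤ᵐ[volume.restrict strip] fun p => radialWeight p.1 ^ 2 * u p ^ 2 :=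
    ae_of_all _ fun p => mul_nonneg (sq_nonneg _) (sq_nonneg _)
  have hI : IntegrableOn (fun p => radialWeight p.1 ^ 2 * u p ^ 2) strip := by
    refine ⟨hmeasL, ?_⟩
    rw [hasFiniteIntegral_iff_ofReal hnn]
    exact hle.trans_lt ENNReal.ofReal_lt_top
  refine ⟨hI, ?_⟩
  have := integral_eq_lintegral_of_nonneg_ae hnn hmeasL
  rw [this]
  calc (∫⁻ p in strip, ENNReal.ofReal (radialWeight p.1 ^ 2 * u p ^ 2)).toReal ≤ (ENNReal.ofReal (4 * M)).toReal :=
        ENNReal.toReal_mono ENNReal.ofReal_ne_top hle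
    _ = 4 * M := ENNReal.toReal_ofReal (by positivity)
    _ ≤ 16 * M := by linarith

end Elgindi

end Literature.Analysis.FluidPDE
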